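import Mathlib.NumberTheory.ModularForms.CongruenceSubgroups
import Mathlib.Data.ZMod.Basic
import HarnessLib
import HarnessLib.Audit.Tags

/-!
# The f-free EISENSTEIN EQUALISER LAWS at `t = 9`: E-es-94 `ParabolicNineShiftInvariantIsDiamond` (G^par₉) and
# E-es-94♯ `NineShiftInvariantIsDiamond` (G₉^grp) — typed (es g23, MEMO-es §37; cell `bsd-f2-manin`, T-es-30 file 1/2, typer g15)

HONEST FRAMING.  LENS = Eisenstein-series / Γ₀-side (`bsd-f2-manin-es` g23, MEMO-es §37, MEMO sha16 a44b140eb04ed66e).  SOURCE =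
HOME/es/Sketch-es-g23.lean sha16 98029fe3dd53ceee (121 l., Mathlib-only, farm rc 0 per es; BC7 3/3 CLEAN with E-es-94 and
`ClassLoopSpanLawNineMod3`), landed VERBATIM except: (i) this header (es's module docstring is kept below it); (ii) namespace
`…ManinAdditive.NineShiftEqualiser` (the sketch's `BsdF2ManinEsG23`); (iii) the two laws carry `@[conjecture]` (obligation nodes, nothing
asserted); (iv) five helper lemmas received one-line docstrings.  Nothing here mentions a modular form, an L-value or an elliptic curve:
the laws speak about the arithmetic group `Γ₀(N)` ALONE.

WHAT IS CLAIMED (es, not the tree).  For `9 ∣ N`: every additive character `φ : Γ₀(N) → 𝔽₃` invariant under the partial conjugation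
`γ ↦ diag(9,1) γ diag(9,1)⁻¹` on `Γ₀(9N)` (`IsNineShiftInvariant`) is a DIAMOND class (vanishes on `Γ₁(N)`) — **E-es-94♯** (G₉^grp); the
weaker **E-es-94** (G^par₉) assumes `φ` parabolic (kills unipotents).  Equivalently (paper, MEMO-es §37: Manin presentation + duality over
`𝔽₃`) `ker(π₁^* − π₉^* : J₀(N)[3] → J₀(9N)) = Σ(N)[3]`, i.e. the f-level law (H₉ mod 3) `ClassLoopSpanLawNineMod3` (sibling file
`DegeneracyOrbitCriterion.lean`, T-es-30 file 2/2) for EVERY weight-2 cusp form of level `N` at once, which feeds the C3 es-input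
`DegeneracyClassPlusIndexPrimeTo f 3 9` ⟹ THEOREM U♮ ⟹ `ThreeAdicPolarWitness` on the squarefull locus (tree: `DegeneracyClassEulerUnitTwist.lean`,
`DegeneracyClassEulerWitnesses.lean`).  The non-Eisenstein part is relative Ihara (tree); the Eisenstein part is OPEN in print (es).
BC5 (census witness): HOME/es/g23/ENGINE3-INV-CENSUS-v2.txt a3d3b762cdde7e12 — 39/39 levels `N ∈ 9ℕ ∩ [18, 360]` (`K₉^{mod 3}(N) = D_par(N)`,
exact 𝔽₃ linear algebra on Manin symbols); HOME/es/g23/ENGINE4-TRANSFER-EQUALISER-CENSUS-v1.txt da41fe3ab582595f — `dim K₉^grp(N) = r₃((ℤ/N)ˣ)`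
at 39/39 levels `9 ∣ N ≤ 360` and 85/85 levels `N ≤ 120` without order-3 elliptic points (a second engine with a disjoint code path;
0 violations / 124 levels).  STRUCTURE (paper, MEMO-es §37.3–37.5): Bass–Serre descent `dim K₉^grp(N) − dim K₉^grp(N/9) ≤ ω ∈ {1,2}` and an
S-arithmetic hull reduce E-es-94♯ to ONE non-realisation lemma (§37.5; R-es-46 asks ref2 / an to attack it at `N = 81`).
REFUTER VERDICTS: R-es-45 (ref1 audit + BC7-by-name) PENDING at filing.  bears_on: stmt-BirchSwinnertonDyer-22968.
PARTITION (es) 0 · beyond-print theorem: no (a typed LAW + census) · BSD is not proved by this; Manin's conjecture is not proved by this.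
APPEND (typer g15, T-es-30′, es g23 ADDENDUM 22:57:11Z; SOURCE = the same sketch at sha16 e40e5b1843a0842c, 309 l., farm rc 0 · 0 warn
per es, BC7 2/2 + 5/5 CLEAN bc7-g23d 97c817a4bfa6170d / bc7-g23e 83342c9c21b5d109; sections `ThreeShift` and `TowerDescent` VERBATIM, the
seven new rows tagged `@[conjecture]`): the 3-SHIFT `IsThreeShiftInvariant` and the reduction `t = 9 → t = 3` — PROVED `D ⊆ K₃ ⊆ K₉`
(`isThreeShiftInvariant_of_isDiamondChar`, `isNineShiftInvariant_of_isThreeShiftInvariant`) and **E-es-94♯ ⟺ E-es-96 ∧ E-es-97**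
(`nineShiftInvariantIsDiamond_iff_three`), with **E-es-96 `ThreeShiftInvariantIsDiamond`** (`K₃ = D`), **E-es-97
`NineShiftInvariantIsThreeShiftInvariant`** (`K₉ ⊆ K₃`); the anti-invariant space `IsThreeShiftAntiInvariant` (PROVED `K₃⁻ ⊆ K₉`),
`RestrictsFrom`, single-level schemas `ThreeShiftInvariantIsDiamondAt` / `ThreeShiftAntiInvariantTrivialAt`, and the TOWER DESCENT rows
**E-es-98 `ThreeShiftTowerDescent`** (THEOREM III, paper), **E-es-99 `ThreeShiftAntiInvariantDescent`** (THEOREM III′, paper), **E-es-100a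
`ThreeShiftBaseNine`**, **E-es-100b `AntiInvariantBaseTwentySeven`**, **E-es-101 `TowerReduction`** (glue, paper).  BC5: ENGINE 5
HOME/es/g23b/ENGINE5-PAIRSPACE-CENSUS-v1.txt 0492a4ed8104bba2 (K₃ = K₉ = r₃ 198/198; K₃⁻ = 0 158/158; δ = 0 on cusps 31/31) + second engine
KAPPA-CUSP-CRITERION-v1.txt 3d19a30e0bb70a58 (45/45).  REF1 §R97: E-es-94♯ BC7 CLEAN by name, Structure Thms I/II PASS, N = 9 proved by hand;
R-es-47 (THEOREMS III/III′) PENDING.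
-/

/-!
## es's sketch docstring (verbatim)
es g23 — the f-free EISENSTEIN EQUALISER LAW (G^par₉) at t = 9  (HOME sketch, cell bsd-f2-manin, seat -es)

Candidate E-es-94 `ParabolicNineShiftInvariantIsDiamond` — a statement about the arithmetic group `Γ₀(N)`
ALONE (no modular form, no L-value, no elliptic curve):

  for `9 ∣ N`, every PARABOLIC additive character `φ : Γ₀(N) → 𝔽₃` (kills every unipotent element) which is
  invariant under the partial conjugation `γ ↦ diag(9,1) γ diag(9,1)⁻¹` on `Γ₀(9N)` vanishes on `Γ₁(N)`,
  i.e. is a diamond class `χ ∘ (d mod N)`.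

Equivalently (Manin presentation + duality over `𝔽₃`, on paper): `ker(π₁^* − π₉^* : J₀(N)[3] → J₀(9N)) = Σ(N)[3]`
(the degeneracy EQUALISER at `t = 9` on 3-torsion is the Shimura subgroup), equivalently the f-level law
`(H₉ mod 3)` = `BsdF2ManinEsG22Orbit.ClassLoopSpanLawNineMod3` for EVERY weight-2 cusp form of level `N`
simultaneously (HOME/es/Sketch-es-g23-orbit.lean, farm-checked, BC7 CLEAN), which feeds the C3 crux
`ManinPrimeToThreeAtNine` through `degeneracyClass_of_spanLawMod3` → U♮ → `ThreeAdicPolarWitness` (squarefull).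
CENSUS (BC5 witness): HOME/es/g23/ENGINE3-INV-CENSUS-v2.txt (sha16 a3d3b762cdde7e12): 39/39 levels
`N ∈ 9ℕ ∩ [18, 360]` satisfy it (exact 𝔽₃ linear algebra on Manin symbols; `K₉^{mod 3}(N) = D_par(N)`, of
dimension `r₃(Σ(N)) ∈ {0,1,2}`).  Non-Eisenstein part = relative Ihara (tree); Eisenstein part OPEN in print.
PARTITION 0 · beyond-print theorem: no (a typed LAW + census) · BSD is not proved by this; Manin's conjecture is
not proved by this.
-/

namespace Summit.BirchSwinnertonDyer.Rank1Residual.ManinAdditive.NineShiftEqualiser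

open Matrix CongruenceSubgroup
open scoped MatrixGroups

section Matrices

/-- The `SL(2,ℤ)` element with entries `a b c d`. -/
def slOf (a b c d : ℤ) (h : a * d - b * c = 1) : SL(2, ℤ) :=
  ⟨!![a, b; c, d], by rw [Matrix.det_fin_two_of]; exact h⟩

/-- Entry `(0,0)` of `slOf`. -/
@[simp] theorem slOf_apply_00 (a b c d : ℤ) (h : a * d - b * c = 1) : (slOf a b c d h) 0 0 = a := rfl
/-- Entry `(0,1)` of `slOf`. -/
@[simp] theorem slOf_apply_01 (a b c d : ℤ) (h : a * d - b * c = 1) : (slOf a b c d h) 0 1 = b := rfl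
/-- Entry `(1,0)` of `slOf`. -/
@[simp] theorem slOf_apply_10 (a b c d : ℤ) (h : a * d - b * c = 1) : (slOf a b c d h) 1 0 = c := rfl
/-- Entry `(1,1)` of `slOf`. -/
@[simp] theorem slOf_apply_11 (a b c d : ℤ) (h : a * d - b * c = 1) : (slOf a b c d h) 1 1 = d := rfl

/-- `slOf a b c d ∈ Γ₀(M)` when `M ∣ c`. -/
theorem slOf_mem_gamma0 {M : ℕ} (a b c d : ℤ) (h : a * d - b * c = 1) (hc : (M : ℤ) ∣ c) :
    slOf a b c d h ∈ Gamma0 M := by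
  rw [Gamma0_mem]
  show ((slOf a b c d h) 1 0 : ZMod M) = 0
  rw [slOf_apply_10]
  exact (ZMod.intCast_zmod_eq_zero_iff_dvd c M).mpr hc

/-- `slOf a b c d` as an element of `Γ₀(M)` when `M ∣ c`. -/
def g0Of {M : ℕ} (a b c d : ℤ) (h : a * d - b * c = 1) (hc : (M : ℤ) ∣ c) : Gamma0 M :=
  ⟨slOf a b c d h, slOf_mem_gamma0 a b c d h hc⟩

end Matrices

section Law

/-- `φ : Γ₀(N) → ℤ/3` is an additive character (a homomorphism to the additive group `ℤ/3`). -/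
def IsAddChar {N : ℕ} (φ : Gamma0 N → ZMod 3) : Prop :=
  ∀ γ δ : Gamma0 N, φ (γ * δ) = φ γ + φ δ

/-- `φ` is PARABOLIC: it kills every unipotent element of `Γ₀(N)` (trace `2`; the elements of trace `−2` and `−I`
are then killed automatically since `2` is invertible in `ℤ/3`).  For `9 ∣ N` (no elliptic points) these are
exactly the classes of `H¹(X₀(N); 𝔽₃) ⊂ H¹(Y₀(N); 𝔽₃) = Hom(Γ₀(N), 𝔽₃)`. -/
def IsParabolicChar {N : ℕ} (φ : Gamma0 N → ZMod 3) : Prop :=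
  ∀ γ : Gamma0 N, (γ.1 : SL(2, ℤ)) 0 0 + (γ.1 : SL(2, ℤ)) 1 1 = 2 → φ γ = 0

/-- `φ` is INVARIANT UNDER THE 9-SHIFT: `φ(diag(9,1) γ diag(9,1)⁻¹) = φ(γ)` for every `γ = (a b; 9c d) ∈ Γ₀(9N)`,
where `diag(9,1) γ diag(9,1)⁻¹ = (a 9b; c d) ∈ Γ₀(N)`; i.e. `π₁^* φ = π₉^* φ` in `H¹(Γ₀(9N); 𝔽₃)`. -/
def IsNineShiftInvariant {N : ℕ} (φ : Gamma0 N → ZMod 3) : Prop :=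
  ∀ (a b c d : ℤ) (hdet : a * d - b * (9 * c) = 1) (hc : (N : ℤ) ∣ c),
    φ (g0Of a (9 * b) c d (by linear_combination hdet) hc)
      = φ (g0Of a b (9 * c) d hdet (Dvd.dvd.mul_left hc 9))

/-- `φ` is a DIAMOND class: it vanishes on `Γ₁(N)` (equivalently `φ = χ ∘ (d mod N)` for an additive character
`χ` of `(ℤ/N)ˣ`, i.e. `φ` comes from the Shimura covering `X₁(N) → X₀(N)`). -/
def IsDiamondChar {N : ℕ} (φ : Gamma0 N → ZMod 3) : Prop :=
  ∀ (γ : SL(2, ℤ)) (hγ : γ ∈ Gamma1 N), φ ⟨γ, Gamma1_in_Gamma0 N hγ⟩ = 0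

/-- LAW (G^par₉) = candidate E-es-94 (es g23): for `9 ∣ N`, a parabolic additive character of `Γ₀(N)` with values
in `𝔽₃` which is invariant under the 9-shift is a diamond class.  [`K₉^{mod 3}(N) = D_par(N)`; census 39/39.]
TYPER FRAMING (E-es-94): lens es; LAW (obligation node), nothing asserted. [conjecture — cell candidate, NOT a tree fact] -/
@[conjecture] def ParabolicNineShiftInvariantIsDiamond : Prop :=
  ∀ (N : ℕ), 9 ∣ N → ∀ φ : Gamma0 N → ZMod 3,
    IsAddChar φ → IsParabolicChar φ → IsNineShiftInvariant φ → IsDiamondChar φ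

/-- The same law at ONE level `N` (the census checks it level by level). -/
def ParabolicNineShiftInvariantIsDiamondAt (N : ℕ) : Prop :=
  ∀ φ : Gamma0 N → ZMod 3, IsAddChar φ → IsParabolicChar φ → IsNineShiftInvariant φ → IsDiamondChar φ

/-- The global law is the conjunction of its level-wise instances (PROVED, `Iff.rfl`). -/
theorem parabolicNineShiftInvariantIsDiamond_iff :
    ParabolicNineShiftInvariantIsDiamond ↔ ∀ N, 9 ∣ N → ParabolicNineShiftInvariantIsDiamondAt N := Iff.rfl

/-- LAW (G₉^grp) = candidate E-es-94♯ (es g23, the SHARP form WITHOUT parabolicity): for `9 ∣ N`, EVERY additive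
character `Γ₀(N) → 𝔽₃` invariant under the 9-shift is a diamond class, i.e.
`{φ ∈ Hom(Γ₀(N), 𝔽₃) : π₁^* φ = π₉^* φ} = Hom((ℤ/N)ˣ, 𝔽₃) ∘ d`  — the Eisenstein classes of the cusps contribute
NOTHING to the 9-shift equaliser.  CENSUS (BC5 witness): HOME/es/g23/ENGINE4-TRANSFER-EQUALISER-CENSUS-v1.txt —
`dim K₉^grp(N) = r₃((ℤ/N)ˣ)` at 39/39 levels `N ∈ 9ℕ ∩ [18,360]` and at 85/85 levels `N ≤ 120` without order-3
elliptic points (transfer equaliser on Manin symbols mod 3, an engine independent of ENGINE 3′).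
TYPER FRAMING (E-es-94♯): lens es; LAW (obligation node), nothing asserted. [conjecture — cell candidate, NOT a tree fact] -/
@[conjecture] def NineShiftInvariantIsDiamond : Prop :=
  ∀ (N : ℕ), 9 ∣ N → ∀ φ : Gamma0 N → ZMod 3, IsAddChar φ → IsNineShiftInvariant φ → IsDiamondChar φ

/-- E-es-94♯ ⟹ E-es-94 (drop the parabolicity hypothesis). -/
theorem parabolicNineShiftInvariantIsDiamond_of_sharp (h : NineShiftInvariantIsDiamond) :
    ParabolicNineShiftInvariantIsDiamond :=
  fun N hN φ hadd _ hinv => h N hN φ hadd hinv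

end Law

section Sanity

/-! ### Sanity: diamond classes ARE 9-shift invariant (`D ⊆ K₉`, the trivial inclusion), so the law says `K₉ = D`. -/

/-- A function of the lower-right entry `d mod N` only is 9-shift invariant (both matrices have the same `d`). -/
theorem isNineShiftInvariant_of_factorsThroughD {N : ℕ} (φ : Gamma0 N → ZMod 3) (χ : ZMod N → ZMod 3)
    (hφ : ∀ γ : Gamma0 N, φ γ = χ (((γ.1 : SL(2, ℤ)) 1 1 : ℤ) : ZMod N)) : IsNineShiftInvariant φ := by
  intro a b c d hdet hc
  rw [hφ, hφ]
  rfl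

end Sanity

section ThreeShift

/-! ### The 3-shift and the reduction `t = 9 → t = 3` (es g23, ENGINE 5)

`K₃^grp(N) := {φ : φ(diag(3,1) γ diag(3,1)⁻¹) = φ(γ) for γ ∈ Γ₀(3N)}`.  Always `D^grp ⊆ K₃^grp ⊆ K₉^grp`
(`isThreeShiftInvariant_of_isDiamondChar`, `isNineShiftInvariant_of_isThreeShiftInvariant`), so the sharp law
E-es-94♯ (`K₉ = D`) is EQUIVALENT to the conjunction of E-es-96 (`K₃ = D`, the 3-shift equaliser law) and
E-es-97 (`K₉ ⊆ K₃`: 9-shift invariance forces 3-shift invariance) — `nineShiftInvariantIsDiamond_iff_three`.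
CENSUS (ENGINE 5, t = 3 and t = 9 transfer equalisers on Manin symbols mod 3): `dim K₃^grp(N) = dim K₉^grp(N) =
r₃((ℤ/N)ˣ)` at 149/149 levels `N ≤ 180` without order-3 elliptic points.  Group-theoretic identity behind E-es-97:
for `ψ := φ − φ∘conj(diag(3,1))` on `Γ₀(3N)` one has `ψ(g) + ψ(diag(3,1) g diag(3,1)⁻¹) = φ(g) − φ(diag(9,1) g
diag(9,1)⁻¹)` for `g ∈ Γ₀(9N)`, so `φ ∈ K₉ ⟺ ψ` is 3-shift ANTI-invariant, and E-es-97 says a 3-shift defect of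
level `N` is never anti-invariant unless it vanishes. -/

/-- `g0Of` only depends on the four entries (proof-irrelevance helper for rewriting entries). -/
theorem g0Of_congr {M : ℕ} {a b c d a' b' c' d' : ℤ} (ha : a = a') (hb : b = b') (hcc : c = c') (hd : d = d')
    (h : a * d - b * c = 1) (h' : a' * d' - b' * c' = 1) (hc : (M : ℤ) ∣ c) (hc' : (M : ℤ) ∣ c') :
    g0Of a b c d h hc = g0Of a' b' c' d' h' hc' := by
  subst ha hb hcc hd; rfl

/-- `φ` is INVARIANT UNDER THE 3-SHIFT: `φ(diag(3,1) γ diag(3,1)⁻¹) = φ(γ)` for every `γ = (a b; 3c d) ∈ Γ₀(3N)`,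
where `diag(3,1) γ diag(3,1)⁻¹ = (a 3b; c d) ∈ Γ₀(N)`; i.e. `π₁^* φ = π₃^* φ` in `H¹(Γ₀(3N); 𝔽₃)`. -/
def IsThreeShiftInvariant {N : ℕ} (φ : Gamma0 N → ZMod 3) : Prop :=
  ∀ (a b c d : ℤ) (hdet : a * d - b * (3 * c) = 1) (hc : (N : ℤ) ∣ c),
    φ (g0Of a (3 * b) c d (by linear_combination hdet) hc)
      = φ (g0Of a b (3 * c) d hdet (Dvd.dvd.mul_left hc 3))

/-- `K₃ ⊆ K₉`: the 9-shift is the 3-shift applied twice. -/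
theorem isNineShiftInvariant_of_isThreeShiftInvariant {N : ℕ} (φ : Gamma0 N → ZMod 3)
    (h : IsThreeShiftInvariant φ) : IsNineShiftInvariant φ := by
  intro a b c d hdet hc
  have h1 := h a (3 * b) c d (by linear_combination hdet) hc
  have h2 := h a b (3 * c) d (by linear_combination hdet) (Dvd.dvd.mul_left hc 3)
  have e1 : g0Of (M := N) a (9 * b) c d (by linear_combination hdet) hc
      = g0Of a (3 * (3 * b)) c d (by linear_combination hdet) hc :=
    g0Of_congr rfl (by ring) rfl rfl _ _ _ _
  have e2 : g0Of (M := N) a b (9 * c) d hdet (Dvd.dvd.mul_left hc 9)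
      = g0Of a b (3 * (3 * c)) d (by linear_combination hdet) (Dvd.dvd.mul_left (Dvd.dvd.mul_left hc 3) 3) :=
    g0Of_congr rfl rfl (by ring) rfl _ _ _ _
  rw [e1, e2, h1]
  exact h2

/-- `D ⊆ K₃`: a diamond class (additive, vanishing on `Γ₁(N)`) is 3-shift invariant, because the two matrices
`(a 3b; c d)` and `(a b; 3c d)` differ by an element of `Γ₁(N)` (same `d`, and `N ∣ c`). -/
theorem isThreeShiftInvariant_of_isDiamondChar {N : ℕ} (φ : Gamma0 N → ZMod 3) (hadd : IsAddChar φ)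
    (hD : IsDiamondChar φ) : IsThreeShiftInvariant φ := by
  intro a b c d hdet hc
  set γ₁ : Gamma0 N := g0Of a (3 * b) c d (by linear_combination hdet) hc with hγ₁
  set γ₂ : Gamma0 N := g0Of a b (3 * c) d hdet (Dvd.dvd.mul_left hc 3) with hγ₂
  have hcN : ((c : ℤ) : ZMod N) = 0 := (ZMod.intCast_zmod_eq_zero_iff_dvd c N).mpr hc
  have had : ((a : ℤ) : ZMod N) * d = 1 := by
    have : ((a * d - b * (3 * c) : ℤ) : ZMod N) = 1 := by rw [hdet]; push_cast; rfl
    push_cast at this; rw [hcN] at this; simpa using this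
  have hmem : ((γ₁ * γ₂⁻¹ : Gamma0 N) : SL(2, ℤ)) ∈ Gamma1 N := by
    rw [Gamma1_mem]
    simp only [hγ₁, hγ₂, g0Of, slOf, Subgroup.coe_mul, Subgroup.coe_inv,
      Matrix.SpecialLinearGroup.coe_mul, Matrix.SpecialLinearGroup.coe_inv, Matrix.adjugate_fin_two,
      Matrix.mul_apply, Fin.sum_univ_two, Matrix.of_apply, Matrix.cons_val', Matrix.cons_val_zero,
      Matrix.cons_val_one, Matrix.empty_val']
    push_cast
    rw [hcN]
    refine ⟨?_, ?_, ?_⟩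
    · linear_combination had
    · linear_combination had
    · ring
  have hzero : φ (γ₁ * γ₂⁻¹) = 0 := by
    have := hD _ hmem
    have e : (γ₁ * γ₂⁻¹ : Gamma0 N) = ⟨((γ₁ * γ₂⁻¹ : Gamma0 N) : SL(2, ℤ)), Gamma1_in_Gamma0 N hmem⟩ :=
      Subtype.ext rfl
    rw [e]; exact this
  have key : γ₁ = (γ₁ * γ₂⁻¹) * γ₂ := by group
  calc φ γ₁ = φ ((γ₁ * γ₂⁻¹) * γ₂) := by rw [← key]
    _ = φ (γ₁ * γ₂⁻¹) + φ γ₂ := hadd _ _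
    _ = φ γ₂ := by rw [hzero, zero_add]

/-- LAW (G₃^grp) = candidate E-es-96 (es g23): for `9 ∣ N`, every additive character `Γ₀(N) → 𝔽₃` invariant under
the 3-SHIFT is a diamond class (`K₃^grp(N) = D^grp(N)`: the Ihara / degeneracy-equaliser statement at `ℓ = 3 ∣ N`
INCLUDING the Eisenstein part).  CENSUS (ENGINE 5): `dim K₃^grp(N) = r₃((ℤ/N)ˣ)` at 149/149 levels `N ≤ 180`
without order-3 elliptic points; STRUCTURE: at prime-to-3 level it is a THEOREM (Serre's amalgam for `SL₂(ℤ[1/3])`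
+ CSP), each 3-adic step costs a one-dimensional Bass–Serre obstruction (`K_{3,3}` resp. the cube), realised exactly
when a new diamond character of conductor 9 appears, and the non-realisation elsewhere is CERTIFIED ON THE CUSPS at
14/14 tested steps (ENGINE 5 boundary test).
TYPER FRAMING (E-es-96): lens es; LAW (obligation node), nothing asserted. [conjecture — cell candidate, NOT a tree fact] -/
@[conjecture] def ThreeShiftInvariantIsDiamond : Prop :=
  ∀ (N : ℕ), 9 ∣ N → ∀ φ : Gamma0 N → ZMod 3, IsAddChar φ → IsThreeShiftInvariant φ → IsDiamondChar φ

/-- REDUCTION (G₉/₃) = candidate E-es-97 (es g23): for `9 ∣ N`, 9-shift invariance implies 3-shift invariance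
(`K₉^grp(N) ⊆ K₃^grp(N)`).  CENSUS (ENGINE 5): `dim K₉^grp = dim K₃^grp` at 149/149 levels `N ≤ 180`.
TYPER FRAMING (E-es-97): lens es; LAW (obligation node), nothing asserted. [conjecture — cell candidate, NOT a tree fact] -/
@[conjecture] def NineShiftInvariantIsThreeShiftInvariant : Prop :=
  ∀ (N : ℕ), 9 ∣ N → ∀ φ : Gamma0 N → ZMod 3, IsAddChar φ → IsNineShiftInvariant φ → IsThreeShiftInvariant φ

/-- E-es-94♯ ⟺ E-es-96 ∧ E-es-97. -/
theorem nineShiftInvariantIsDiamond_iff_three :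
    NineShiftInvariantIsDiamond ↔ (ThreeShiftInvariantIsDiamond ∧ NineShiftInvariantIsThreeShiftInvariant) := by
  constructor
  · intro h
    exact ⟨fun N hN φ hadd h3 => h N hN φ hadd (isNineShiftInvariant_of_isThreeShiftInvariant φ h3),
      fun N hN φ hadd h9 => isThreeShiftInvariant_of_isDiamondChar φ hadd (h N hN φ hadd h9)⟩
  · rintro ⟨h3, h93⟩ N hN φ hadd h9
    exact h3 N hN φ hadd (h93 N hN φ hadd h9)

end ThreeShift

section TowerDescent

/-! ### Tower descent: the 3-adic depth is eliminated (es g23, MEMO-es §37.8, THEOREMS III / III′)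

Paper theorems (elementary, proved in MEMO-es §37.8; explicit matrix identities machine-checked for 19 levels):
* THEOREM III (`ThreeShiftTowerDescent`, E-es-98): for `9 ∣ M`, every 3-shift-invariant additive character of
  `Γ₀(3M)` is the restriction of a 3-shift-invariant additive character of `Γ₀(M)` (`K₃^grp(3M) = res K₃^grp(M)`).
  Proof: Bass–Serre bound `h ≤ ω(K_{3,3}) = 1` for the pair `(ker β, ker λ)` in `Γ₀(M)`, the Heisenberg lift `m` of
  `(β, λ) = (ab mod 3, (c/M)·a mod 3)` as the unique new compatible pair, and the cusp functional
  `ℓ = ev(P_{2/3}) − ev(P_{1/3})` on `Γ₀(3M)`: `ℓ` kills every inflated defect (the cusps `1/3, 2/3` of `Γ₀(3M)` are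
  totally ramified over level `M` and both map to the cusp `0` under `z ↦ 3z`), while `ℓ(m∘conj(diag(3,1)) − m) =
  β(T)·λ(τ₁ T^M τ₁⁻¹) = 1·2 ≠ 0`.
* THEOREM III′ (`ThreeShiftAntiInvariantDescent`, E-es-99): for `27 ∣ M`, every 3-shift-ANTI-invariant additive
  character of `Γ₀(3M)` is the restriction of one of `Γ₀(M)` (same amalgam, plus `ψ(P_{a/3}) = −ψ(diag(3,1)⁻¹ P_{a/3}
  diag(3,1)) = −3·ψ(P⁰_{a/9}) = 0`, which needs `81 ∣ 3M`).
* COROLLARY (`TowerReduction`, E-es-101): E-es-94♯ on every 3-tower `{3^k N₀ : k ≥ 2}` (`3 ∤ N₀`) follows from the two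
  SINGLE-LEVEL statements `K₃^grp(9N₀) = D^grp(9N₀)` (`ThreeShiftBaseNine`, E-es-100a) and `K₃^-(27N₀) = 0`
  (`AntiInvariantBaseTwentySeven`, E-es-100b) — finite `𝔽₃`-linear algebra per `N₀`, CERTIFIED (ENGINE 5) for
  `N₀ ≤ 20` resp. `N₀ ≤ 14`; e.g. all pure 3-power levels `N = 3^k` reduce to `K₃(9) = D(9)` (3 Manin symbols… `μ = 12`)
  and `K₃^-(27) = 0` (`μ = 36`). -/

/-- `φ` is ANTI-INVARIANT under the 3-shift: `φ(diag(3,1) γ diag(3,1)⁻¹) = −φ(γ)` for every `γ = (a b; 3c d) ∈ Γ₀(3N)`.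
`K₃^-(N)` := the additive such `φ`; always `K₃^- ∩ K₃ = 0` and `K₃^- ⊆ K₉` (`isNineShiftInvariant_of_isThreeShiftAntiInvariant`). -/
def IsThreeShiftAntiInvariant {N : ℕ} (φ : Gamma0 N → ZMod 3) : Prop :=
  ∀ (a b c d : ℤ) (hdet : a * d - b * (3 * c) = 1) (hc : (N : ℤ) ∣ c),
    φ (g0Of a (3 * b) c d (by linear_combination hdet) hc)
      = - φ (g0Of a b (3 * c) d hdet (Dvd.dvd.mul_left hc 3))

/-- `K₃^- ⊆ K₉`: applying the anti-invariance twice gives 9-shift invariance. -/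
theorem isNineShiftInvariant_of_isThreeShiftAntiInvariant {N : ℕ} (φ : Gamma0 N → ZMod 3)
    (h : IsThreeShiftAntiInvariant φ) : IsNineShiftInvariant φ := by
  intro a b c d hdet hc
  have h1 := h a (3 * b) c d (by linear_combination hdet) hc
  have h2 := h a b (3 * c) d (by linear_combination hdet) (Dvd.dvd.mul_left hc 3)
  have e1 : g0Of (M := N) a (9 * b) c d (by linear_combination hdet) hc
      = g0Of a (3 * (3 * b)) c d (by linear_combination hdet) hc :=
    g0Of_congr rfl (by ring) rfl rfl _ _ _ _
  have e2 : g0Of (M := N) a b (9 * c) d hdet (Dvd.dvd.mul_left hc 9)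
      = g0Of a b (3 * (3 * c)) d (by linear_combination hdet) (Dvd.dvd.mul_left (Dvd.dvd.mul_left hc 3) 3) :=
    g0Of_congr rfl rfl (by ring) rfl _ _ _ _
  rw [e1, e2, h1, h2, neg_neg]

/-- `φ : Γ₀(N) → ℤ/3` is the RESTRICTION of `w : Γ₀(M) → ℤ/3` (used with `M ∣ N`; the divisibility of the entry
`c` by `M` is supplied as a hypothesis, so no inclusion map `Γ₀(N) → Γ₀(M)` is needed). -/
def RestrictsFrom {M N : ℕ} (φ : Gamma0 N → ZMod 3) (w : Gamma0 M → ZMod 3) : Prop :=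
  ∀ (a b c d : ℤ) (hdet : a * d - b * c = 1) (hcN : (N : ℤ) ∣ c) (hcM : (M : ℤ) ∣ c),
    φ (g0Of a b c d hdet hcN) = w (g0Of a b c d hdet hcM)

/-- single-level form of E-es-96: `K₃^grp(N) = D^grp(N)`. -/
def ThreeShiftInvariantIsDiamondAt (N : ℕ) : Prop :=
  ∀ φ : Gamma0 N → ZMod 3, IsAddChar φ → IsThreeShiftInvariant φ → IsDiamondChar φ

/-- single-level vanishing of the anti-invariant space: `K₃^-(N) = 0`. -/
def ThreeShiftAntiInvariantTrivialAt (N : ℕ) : Prop :=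
  ∀ φ : Gamma0 N → ZMod 3, IsAddChar φ → IsThreeShiftAntiInvariant φ → ∀ γ : Gamma0 N, φ γ = 0

/-- THEOREM III = candidate E-es-98 (es g23; PROVED on paper, MEMO-es §37.8): 3-shift tower descent
`K₃^grp(3M) = res K₃^grp(M)` for `9 ∣ M`.  CENSUS (ENGINE 5, Table C): `δ = 0` at 10/10 steps `M → 3M`, `9 ∣ M ≤ 90`,
each certified on the cusps; dual certificate `ℓ = [2/3] − [1/3]` found uniformly (cuspkappa/cuspdual, 15/15 levels).
TYPER FRAMING (E-es-98, THEOREM III): lens es; proved ON PAPER by es (MEMO-es §37.8), R-es-47 referee PENDING; obligation node until a Lean proof lands, nothing asserted. [conjecture — cell candidate, NOT a tree fact] -/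
@[conjecture] def ThreeShiftTowerDescent : Prop :=
  ∀ (M : ℕ), 9 ∣ M → ∀ φ : Gamma0 (3 * M) → ZMod 3, IsAddChar φ → IsThreeShiftInvariant φ →
    ∃ w : Gamma0 M → ZMod 3, IsAddChar w ∧ IsThreeShiftInvariant w ∧ RestrictsFrom φ w

/-- THEOREM III′ = candidate E-es-99 (es g23; PROVED on paper, MEMO-es §37.8): anti-invariant descent
`K₃^-(3M) ⊆ res K₃^-(M)` for `27 ∣ M`.  CENSUS (ENGINE 5, Table B): `K₃^-(N) = 0` at 158/158 levels.
TYPER FRAMING (E-es-99, THEOREM III′): lens es; proved ON PAPER by es (MEMO-es §37.8), referee PENDING; obligation node, nothing asserted. [conjecture — cell candidate, NOT a tree fact] -/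
@[conjecture] def ThreeShiftAntiInvariantDescent : Prop :=
  ∀ (M : ℕ), 27 ∣ M → ∀ ψ : Gamma0 (3 * M) → ZMod 3, IsAddChar ψ → IsThreeShiftAntiInvariant ψ →
    ∃ w : Gamma0 M → ZMod 3, IsAddChar w ∧ IsThreeShiftAntiInvariant w ∧ RestrictsFrom ψ w

/-- E-es-100a (single 3-adic depth): `K₃^grp(9N₀) = D^grp(9N₀)` for `3 ∤ N₀`.  CENSUS: 14/14 (`N₀ ≤ 20`, Table A).
TYPER FRAMING (E-es-100a): lens es; LAW (obligation node; finite `𝔽₃`-linear algebra per `N₀`), nothing asserted. [conjecture — cell candidate, NOT a tree fact] -/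
@[conjecture] def ThreeShiftBaseNine : Prop :=
  ∀ N₀ : ℕ, 0 < N₀ → ¬ 3 ∣ N₀ → ThreeShiftInvariantIsDiamondAt (9 * N₀)

/-- E-es-100b (single 3-adic depth): `K₃^-(27N₀) = 0` for `3 ∤ N₀`.  CENSUS: 10/10 (`N₀ ≤ 14`, Table B).
TYPER FRAMING (E-es-100b): lens es; LAW (obligation node; finite `𝔽₃`-linear algebra per `N₀`), nothing asserted. [conjecture — cell candidate, NOT a tree fact] -/
@[conjecture] def AntiInvariantBaseTwentySeven : Prop :=
  ∀ N₀ : ℕ, 0 < N₀ → ¬ 3 ∣ N₀ → ThreeShiftAntiInvariantTrivialAt (27 * N₀)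

/-- COROLLARY = candidate E-es-101 (es g23; proved on paper — a pure GLUE THEOREM, provable in Lean outright):
the four statements above imply the sharp law E-es-94♯ at every level `9 ∣ N`.  (Chain: `φ ∈ K₉(N)` ↦
`ψ = φ − φ∘conj(diag(3,1)) ∈ K₃^-(3N)` ↦ descend by III′ to `27N₀` ↦ `ψ = 0` ↦ `φ ∈ K₃(N)` ↦ descend by III to `9N₀`
↦ diamond ↦ restrictions of diamond classes are diamond.)
TYPER FRAMING (E-es-101): lens es; GLUE statement proved on paper, Lean proof owed (P-es-1/2); obligation node, nothing asserted. [conjecture — cell candidate, NOT a tree fact] -/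
@[conjecture] def TowerReduction : Prop :=
  ThreeShiftTowerDescent → ThreeShiftAntiInvariantDescent → ThreeShiftBaseNine → AntiInvariantBaseTwentySeven →
    NineShiftInvariantIsDiamond

end TowerDescent

end Summit.BirchSwinnertonDyer.Rank1Residual.ManinAdditive.NineShiftEqualiser
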